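import Summits.ABC.ABC.Theses.IUTThetaPilot
import Summits.ABC.IUTFork.LDHGenuinePerImageExplicit
import HarnessLib

/-!
# Crux `ThetaPartII` (stmt-ABC-19678): the two registered layer-2 lines (U) and (P) — the implications between their stubs

The registered union skeleton (abc-iut-c312-8, sha16 76b99b29aaa7c8f6, abc-iut-plan R-g8-1) carries five stubs: the (U)-line
`stub_thetaData` / `stub_cor312` / `stub_hullVolume` (line of record; `−|log(Θ)|` = hull of the UNION of the
(Ind1)(Ind2)-images, [IUTchIII] Cor. 3.12 p. 174) and the (P)-line `stub_cor312PerImage` / `stub_hullVolumePerImage`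
(`−|log(Θ)|` read per image, proof Step (x) p. 181). This PROOF-ONLY helper records, at the level of the REGISTERED
SIGNATURES, the two one-way bridges abc-iut-S7 proved datum by datum (`LDHGenuinePerImageExplicit`, p421120: `vol_(P) ≤
vol_(U)`):

* `ThetaPartII.stub_cor312_of_perImage` — the (P) crux stub implies the (U) crux stub ((iii-P) ⟹ (iii): Cor. 3.12 per image
  is the STRONGER hypothesis; `Cor22.cor312AtDatum_of_perImage`);
* `ThetaPartII.stub_hullVolumePerImage_of_hullVolume` — the (U) computable-half stub implies the (P) one ((ii′) ⟹ (ii′-P);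
  `Cor22.hullVolumePerImageAtDatum_of_hullVolumeAtDatum`).

So the lines cross: (iii-P) ⟹ (iii) and (ii′) ⟹ (ii′-P); neither triple implies the other, and whichever closes first closes the
crux (`ThetaPartII_of`, `ThetaPartII_of_perImage` in the skeleton). Bookkeeping only; TAKES NO SIDE on [IUTchIII] Cor. 3.12 or
[IUTchIV] Thm. 1.10 Step (v). [cite: Mochizuki2012, IUTchIII Cor. 3.12 p. 174, proof Step (x) p. 181] [claim: Mochizuki2012, status: disputed]
-/

noncomputable section

-- `Summit.<Summit>.<Problem>` is the mandated summit-side namespace (CONVENTIONS §2).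
set_option linter.dupNamespace false

namespace Summit.ABC.ABC.Theorems

namespace ThetaPartII

open Literature.NumberTheory.DiophantineGeometry.GenEll
open Literature.IUT.LogVolume

/-- **(iii-P) ⟹ (iii)**: the registered `stub_cor312PerImage` implies the registered `stub_cor312` (per-image Cor. 3.12 is the
stronger hypothesis, `vol_(P) ≤ vol_(U)`). [cite: Mochizuki2012, IUTchIII Cor. 3.12 p. 174] [claim: Mochizuki2012, status: disputed] -/
theorem stub_cor312_of_perImage
    (h : ∀ P : NFPoint, P ∈ UP → ∀ l : ℕ, l.Prime → 5 ≤ l →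
      Cor22.AdmitsCore P → Cor22.CondP2 P l → Cor22.CondP5 P l → Cor22.CondP6 P l →
      Cor22.Cor312PerImageAtDatum P l) :
    ∀ P : NFPoint, P ∈ UP → ∀ l : ℕ, l.Prime → 5 ≤ l →
      Cor22.AdmitsCore P → Cor22.CondP2 P l → Cor22.CondP5 P l → Cor22.CondP6 P l →
      Cor22.Cor312AtDatum P l :=
  fun P hP l hl h5 hc h2 hP5 h6 => Cor22.cor312AtDatum_of_perImage (h P hP l hl h5 hc h2 hP5 h6)

/-- **(ii′) ⟹ (ii′-P)**: the registered `stub_hullVolume` (B_III, (U)-form) implies the registered `stub_hullVolumePerImage`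
(B_III, (P)-form): every (U)-estimate is a (P)-estimate. [cite: Mochizuki2012, IUTchIV Thm. 1.10 proof Step (v) p. 29]
[claim: Mochizuki2012, status: disputed] -/
theorem stub_hullVolumePerImage_of_hullVolume
    (h : ∀ P : NFPoint, P ∈ UP → ∀ l : ℕ, l.Prime → 5 ≤ l →
      Cor22.AdmitsCore P → Cor22.CondP2 P l → Cor22.CondP5 P l → Cor22.CondP6 P l →
      Cor22.HullVolumeAtDatum P l
        (((l : ℝ) + 1) / 4 *
          ((1 + 12 * (Cor22.dmod P : ℝ) / l) * (P.logDiff + Cor22.logCondAvoid P {2, l})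
            + 2 * Real.log l + 52
            + 20 / 3 * Real.log (((2 ^ 12 * 3 ^ 3 * 5 * Cor22.dmod P : ℕ) : ℝ) * (l : ℝ))
              * (Nat.primeCounting (2 ^ 12 * 3 ^ 3 * 5 * Cor22.dmod P * l) : ℝ)))) :
    ∀ P : NFPoint, P ∈ UP → ∀ l : ℕ, l.Prime → 5 ≤ l →
      Cor22.AdmitsCore P → Cor22.CondP2 P l → Cor22.CondP5 P l → Cor22.CondP6 P l →
      Cor22.HullVolumePerImageAtDatum P l
        (((l : ℝ) + 1) / 4 *
          ((1 + 12 * (Cor22.dmod P : ℝ) / l) * (P.logDiff + Cor22.logCondAvoid P {2, l})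
            + 2 * Real.log l + 52
            + 20 / 3 * Real.log (((2 ^ 12 * 3 ^ 3 * 5 * Cor22.dmod P : ℕ) : ℝ) * (l : ℝ))
              * (Nat.primeCounting (2 ^ 12 * 3 ^ 3 * 5 * Cor22.dmod P * l) : ℝ))) :=
  fun P hP l hl h5 hc h2 hP5 h6 => Cor22.hullVolumePerImageAtDatum_of_hullVolumeAtDatum (h P hP l hl h5 hc h2 hP5 h6)

end ThetaPartII

end Summit.ABC.ABC.Theorems

end
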